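import Mathlib
import Literature.Combinatorics.Optimization.NonnegativeRankJuntaDegree
import Literature.Combinatorics.Optimization.LpFormulationReductions
import Literature.Combinatorics.Optimization.SheraliAdamsLocalDistributionsAlphabet
import HarnessLib

/-!
# Unique Games hardness for LPs (Lee–Raghavendra–Steurer 2015, §7.3: Theorem 7.6 and Corollary 7.7)
# from the Charikar–Makarychev–Makarychev Sherali–Adams gap for Unique Games (STOC 2009, Thm 6.1)

[topic Combinatorics/Optimization]

Lee–Raghavendra–Steurer close their §7 ("Nonnegative rank") with "an illustrative application of the
relation between nonnegative rank and junta-degree (Theorem 7.2)": an LP hardness result for the Unique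
Games problem (§7.3, p. 29 of the held arXiv rendering `paper:arxiv-1411.6317`).  This file TYPES that
subsection in the vocabulary of `NonnegativeRankJuntaDegree.lean` (general finite alphabet, `d`-local
pseudo-densities `IsLocalPseudoDensity`, approximate junta degree `approxJuntaDegree` = eq. (7.1),
general pattern matrix `generalPatternMatrix`, nonnegative factorisations `HasNonnegFactorization`) and
PROVES Theorem 7.6 and Corollary 7.7 from ONE cited third-party input, the Unique Games Sherali–Adams
gap of Charikar–Makarychev–Makarychev (STOC 2009, Theorem 6.1), vendored as the named fact
`CharikarMakarychevMakarychev2009_uniqueGamesSA` (a `def … : Prop`, NOT proved here; D-0014).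

## Printed statements (verbatim up to notation) and how they are rendered

* LRS §7.3 (p. 29): "Fix an integer `q ≥ 1`. An instance `ℑ` of unique games `UG^q` consists of
  variables `X_1,…,X_n` taking values in `[q]` and a collection of predicates `P_1,…,P_M` over these
  variables. Each constraint `P_i` is over a pair of distinct variables `{X_{a_i}, X_{b_i}}` and is
  specified by a bijection `π_i : [q] → [q]` as follows: `P_i(X_{a_i},X_{b_i}) := 𝟙[π_i(X_{a_i}) =
  π_i(X_{b_i})]` [sic — read `𝟙[X_{b_i} = π_i(X_{a_i})]`, the Unique Games constraint of
  [CharikarMakarychevMakarychev2009, §6 p. 13: "assign a label `Λ(u)` to every vertex `u` so as to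
  maximize the number of satisfied constraints `π_{uv}(Λ(u)) = Λ(v)`"]; with one bijection applied to both
  sides the printed indicator would be `𝟙[X_{a_i} = X_{b_i}]`]. The goal is to find an assignment that
  maximizes, over `x ∈ [q]ⁿ`, the number of satisfied constraints: `ℑ(x) := (1/M) Σ_{i=1}^M P_i(x)`.
  Recall that `opt(ℑ) = max_{x ∈ [q]ⁿ} ℑ(x)`. Let `UG^q_n` denote the family of Unique Games instances on
  `n` variables."
  — `UGConstraint q n` (distinct `a ≠ b`, a permutation `perm` of `Fin q`; satisfied by `x` iff
  `x b = perm (x a)`), `UGInstance q n` (`M ≥ 1` constraints, as the tree's `CSPInstance`),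
  `UGInstance.val` (`ℑ(x)`, the FRACTION of satisfied constraints), `UGInstance.OptLE` (`opt(ℑ) ≤ s`).
* "Let `M^{n,UG^q}_{c,s}` denote the matrix with entries `M^{n,UG^q}_{c,s}(ℑ,x) = c − ℑ(x)`, where `ℑ`
  runs over all `UG^q_n` instances with `opt(ℑ) ≤ s`, and all values `x ∈ [q]ⁿ`." — `ugMatrix q n c s`
  (rows `UGSound q n s = {ℑ // opt(ℑ) ≤ s}`).
* **Theorem 7.6 ([CharikarMakarychevMakarychev2009]).** "Fix a number `t ≥ 1` and let `q = 2^t`. Then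
  for every `δ > 0`, there exist `γ, ε > 0`, an `m ≥ 1`, and an instance `ℑ ∈ UG^q_m` such that
  `opt(ℑ) ≤ 1/q + δ`, but `juntadeg^ε(1 − δ − ℑ) ≥ m^γ`.  In fact, the authors of [CMM09] construct a
  lower bound for the `d`-round Sherali-Adams LP relaxation (where `d ≍ m^γ`). But there is an
  equivalence between such lower bounds and the existence of a `d`-local pseudo-density; we refer to
  [ChanLRS13] for a discussion."
  — PROVED from the CMM fact, in the form the citation delivers and Corollary 7.7 needs
  (`LeeRaghavendraSteurer2015_thm76`): for every `t ≥ 1` and `0 < δ ≤ 1/4` there are `γ > 0` and `m₀`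
  such that for EVERY `m ≥ m₀` there are `ε > 0` and `ℑ ∈ UG^q_m` with `opt(ℑ) ≤ 1/q + δ` and
  `juntadeg^ε(1 − δ − ℑ; μ^m) > m^γ` (`μ` = uniform measure on `[q]`, p. 29: "Applying Theorem 7.2
  (with `X = [q]` and `μ` as the uniform measure on `[q]`)"); the literal sentence (`∃ γ, ε, m, ℑ`) is the
  corollary `LeeRaghavendraSteurer2015_thm76_literal`.  RECORDED RENDERING DECISIONS: (i) the printed
  "there exist `γ, ε > 0`, an `m ≥ 1`" does not by itself feed Corollary 7.7 for every `d` (one needs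
  instances with `juntadeg^ε ≥ d + 1` for every `d`, i.e. arbitrarily large `m`; the CMM gap holds for
  all large `m`), whence the typed "for every `m ≥ m₀`", with `ε = ε(m)` (what the equivalence
  "`d` rounds of Sherali–Adams ↔ `d`-local pseudo-density" gives: the pseudo-density has SOME finite
  sup-norm, so SOME `ε > 0` works in eq. (7.1); a uniform `ε` is not claimed); (ii) `δ ≤ 1/4` makes
  `f = 1 − δ − ℑ ≥ 0` (`opt ≤ 1/q + δ ≤ 3/4 ≤ 1 − δ`), as Theorem 7.2 ("`f : X^m → ℝ₊`") and the
  definition of `juntadeg^ε` require — for `f` with negative values the maximum in eq. (7.1) is over an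
  unbounded set; the theorem is about small `δ`.
* **Corollary 7.7.** "For every `t ≥ 1`, `δ > 0`, and `d ≥ 1`, there exists a constant `c > 0` such
  that for all `n ≥ 1`, `nnr(M^{n,UG^q}_{1−δ,1/q+δ}) ≥ c n^d`, where `q = 2^t`.  In the language of
  [ChanLRS13] …, this shows that polynomial-size families of LP relaxations cannot achieve a
  `(1−δ, 1/q+δ)`-approximation for the Unique Games problem."
  — PROVED from the CMM fact (`LeeRaghavendraSteurer2015_cor77`, appended part): for `t ≥ 1`,
  `0 < δ ≤ 1/4` and every `d` there is `c > 0` with `nnr(M^{n,UG^q}_{1−δ,1/q+δ}) ≥ c·n^d` for all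
  `n ≥ 2` ("`nnr ≥ X`" = no nonnegative factorisation of size `r < X`).  RECORDED: `n ≥ 2`, not `n ≥ 1`
  — on one variable there is no constraint over a pair of distinct variables, so `UG^q_1` is empty, the
  matrix has no rows and nonnegative rank `0`; for every `n ≥ 2` a sound instance exists (all `q` cyclic
  shifts on one pair: value `≡ 1/q`, `exists_ugInstance_val_eq`).  Proof = the printed one: plant the
  instance of Theorem 7.6 (with `juntadeg^ε ≥ d + 1`) along every `m`-subset `S ⊆ [n]` — the planted
  instances are sound and `M_n^f`, `f = 1 − δ − ℑ`, is the corresponding submatrix of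
  `M^{n,UG^q}_{1−δ,1/q+δ}` (`hasNonnegFactorization_generalPatternMatrix_of_ugMatrix`) —, then
  Theorem 7.2 (`LeeRaghavendraSteurer2015_thm72_lower'`, PROVED in the tree) gives
  `nnr ≥ min(n^{d+1}, (ε/3)(ε²n/(48m²((d+1)log n + log(‖f‖_∞/‖f‖₁) + log(3/ε))))^{d+1}) ≥ c n^d`.

## The vendored fact (Charikar–Makarychev–Makarychev 2009, Theorem 6.1)

Printed (STOC 2009 proceedings p. 13, held text `paper:doi-10-1145-1536414-1536455`): "**Theorem 6.1.**
Fix a number of labels `q = 2^t`, a real `δ ∈ (0, 1)` and let `Δ = ⌈C(q/δ)²⌉` (for a sufficiently large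
constant `C`). Then for every positive `ε` there exists `γ` depending on `ε` such that for every
sufficiently large `n` there exists an instance of Unique Games on `Δ`-regular graph `G` on `n` vertices
so that (i) The cost of the optimal solution is at most `1/q · (1 + δ)`. (ii) There exists a solution to
the LP relaxation obtained after `r = n^γ` rounds of Sherali–Adams of cost `(1 − ε)`."  (p. 13, before
the theorem: "in order to show that the vector … belongs to the Sherali–Adams LP relaxation it is enough
to prove that for every set of vertices `S` of size at most `O(r)` there exists a distribution of integral
solutions `D_S` such that (i) `x_u(i)` is the probability that `u` has label `i`; and `x_{uv}(ij)` is the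
probability that `u` has label `i`, and `v` has label `j`; (ii) for every two sets `S ⊂ T` the
distributions `D_S` and `D_T` coincide on `S`.")
— `CharikarMakarychevMakarychev2009_uniqueGamesSA`, typed in the tree's general-alphabet Sherali–Adams
currency, the one in which Lee–Raghavendra–Steurer consume it (Thm 7.6: "there is an equivalence between
such lower bounds and the existence of a `d`-local pseudo-density"): for all large `n` some `ℑ ∈ UG^q_n`
with `opt(ℑ) ≤ (1+δ)/q` admits a `⌊n^γ⌋`-local pseudo-density `D` w.r.t. the uniform measure on `[q]ⁿ`
with `E[D·ℑ] ≥ 1 − ε`.  RECORDED RENDERING DECISIONS (none strengthens the print): (a) "`r = n^γ`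
rounds" ↦ locality `⌊n^γ⌋` (round/degree offsets of the lift-and-project bookkeeping, CMM Lemma 2.1
"`k = 2r + 3`", are absorbed by `γ`, which is existential); (b) `γ` may depend on `t, δ, ε` (print: "on
`ε`", with `t, δ` fixed before); (c) the `Δ`-regularity of the constraint graph is part of the printed
conclusion and is NOT typed (no consumer; Lee–Raghavendra–Steurer do not use it); (d) "cost `(1 − ε)`" ↦
`≥ 1 − ε`; (e) the transfer "consistent local distributions ⇒ `d`-local pseudo-density / degree-`d`
pseudoexpectation" is PROVED in the tree for the Boolean alphabet (`SheraliAdamsLocalDistributions.lean`,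
`LocalExpectations.toSA`) and is the warrant printed by Lee–Raghavendra–Steurer (and by
Kothari–Meka–Raghavendra, Thm 7.4 footnote, for the MAX-CUT sibling `CharikarMakarychevMakarychev2009_maxCutSA`)
over `[q]`.  CMM's Theorem 6.1 comes with a proof sketch only (reduction of each of the `t` label
coordinates to MAX 2LIN via their Theorem 5.3); the MAX-CUT case of Theorem 5.3 is PROVED in the tree
(`CharikarMakarychevMakarychev2009_maxCutSA_holds`), the MAX 2LIN / product step is not.

D-0026: exactly ONE new named fact (the CMM Unique Games gap); everything else is proved.  No `sorry`.

## References

* [LeeRaghavendraSteurer2015] J. R. Lee, P. Raghavendra, D. Steurer, *Lower bounds on the size of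
  semidefinite programming relaxations*, STOC 2015, doi:10.1145/2746539.2746599, arXiv:1411.6317; §7.3,
  Thm 7.6, Cor 7.7 (arXiv p. 29), Thm 7.2 (p. 27).  Held text `paper:arxiv-1411.6317`.
* [CharikarMakarychevMakarychev2009] M. Charikar, K. Makarychev, Y. Makarychev, *Integrality gaps for
  Sherali–Adams relaxations*, STOC 2009, 283–292, doi:10.1145/1536414.1536455; §6, Thm 6.1 (p. 13).
  Held text `paper:doi-10-1145-1536414-1536455`.
* [ChanEtAl2016] S. O. Chan, J. R. Lee, P. Raghavendra, D. Steurer, *Approximate constraint satisfaction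
  requires large LP relaxations*, FOCS 2013 / J. ACM 63 (2016); §2.1 (`d`-local expectation functionals),
  §3.5 (non-Boolean alphabets).  Held text `paper:arxiv-1309.0563`.
-/

noncomputable section

open Finset

namespace Literature.Combinatorics.Optimization

/-! ### Unique Games over the alphabet `[q]` -/

/-- A **Unique Games constraint** on `n` variables with labels in `[q]`: a pair of DISTINCT variables
`a ≠ b` and a bijection `π : [q] → [q]`; satisfied by `x ∈ [q]ⁿ` iff `x_b = π(x_a)`.
[cite: LeeRaghavendraSteurer2015, §7.3 (arXiv p. 29)]
[cite: CharikarMakarychevMakarychev2009, §6 (p. 13: "π_{uv}(Λ(u)) = Λ(v)")] -/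
structure UGConstraint (q n : ℕ) where
  /-- the first variable `a` -/
  a : Fin n
  /-- the second variable `b` -/
  b : Fin n
  a_ne_b : a ≠ b
  /-- the bijection `π : [q] → [q]` -/
  perm : Equiv.Perm (Fin q)

namespace UGConstraint

variable {q n : ℕ}

/-- `P(x) = 𝟙[x_b = π(x_a)]`. [cite: LeeRaghavendraSteurer2015, §7.3 (arXiv p. 29)] -/
abbrev sat (C : UGConstraint q n) (x : Fin n → Fin q) : Prop := x C.b = C.perm (x C.a)

end UGConstraint

/-- An **instance of Unique Games `UG^q` on `n` variables**: constraints `P_1, …, P_M` (`M ≥ 1`).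
[cite: LeeRaghavendraSteurer2015, §7.3 (arXiv p. 29)] -/
structure UGInstance (q n : ℕ) where
  /-- number of constraints -/
  M : ℕ
  M_pos : 0 < M
  /-- the constraints `P_1, …, P_M` -/
  cons : Fin M → UGConstraint q n

namespace UGInstance

variable {q n m : ℕ}

/-- The objective `ℑ(x) = (1/M) Σ_i P_i(x)` (fraction of satisfied constraints).
[cite: LeeRaghavendraSteurer2015, §7.3 (arXiv p. 29)] -/
def val (I : UGInstance q n) (x : Fin n → Fin q) : ℝ :=
  (∑ i, if (I.cons i).sat x then (1 : ℝ) else 0) / I.M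

/-- "`opt(ℑ) ≤ s`" (`opt(ℑ) = max_{x ∈ [q]ⁿ} ℑ(x)`). [cite: LeeRaghavendraSteurer2015, §7.3 (arXiv p. 29)] -/
def OptLE (I : UGInstance q n) (s : ℝ) : Prop := ∀ x, I.val x ≤ s

/-- `ℑ(x) ≥ 0`. [cite: LeeRaghavendraSteurer2015, §7.3 (arXiv p. 29)] -/
theorem val_nonneg (I : UGInstance q n) (x : Fin n → Fin q) : 0 ≤ I.val x := by
  unfold val
  exact div_nonneg (sum_nonneg fun i _ => by split_ifs <;> norm_num) (Nat.cast_nonneg _)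

/-- `ℑ(x) ≤ 1`. [cite: LeeRaghavendraSteurer2015, §7.3 (arXiv p. 29)] -/
theorem val_le_one (I : UGInstance q n) (x : Fin n → Fin q) : I.val x ≤ 1 := by
  unfold val
  have hM : (0 : ℝ) < I.M := by exact_mod_cast I.M_pos
  rw [div_le_one hM]
  calc (∑ i, if (I.cons i).sat x then (1 : ℝ) else 0) ≤ ∑ _i : Fin I.M, (1 : ℝ) :=
        sum_le_sum fun i _ => by split_ifs <;> norm_num
    _ = I.M := by simp

/-- Raising the soundness threshold. [cite: LeeRaghavendraSteurer2015, §7.3 (arXiv p. 29)] -/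
theorem OptLE.mono {I : UGInstance q n} {s s' : ℝ} (h : I.OptLE s) (hss' : s ≤ s') : I.OptLE s' :=
  fun x => (h x).trans hss'

/-- **Planting** an `m`-variable instance along an `m`-subset `S ⊆ [n]` (coordinates of `S` in increasing
order, as in the pattern matrix `M_n^f(S,x) = f(x_S)`): the constraint on `(a, b)` becomes the constraint on
`(S(a), S(b))` with the same bijection. [cite: LeeRaghavendraSteurer2015, Cor 7.7 (arXiv p. 29: "Applying Theorem 7.2") and §1 (eq. (1.2): "f(x_S)")] -/
def plant (I : UGInstance q m) (S : {S : Finset (Fin n) // S.card = m}) : UGInstance q n where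
  M := I.M
  M_pos := I.M_pos
  cons i :=
    { a := S.1.orderEmbOfFin S.2 (I.cons i).a
      b := S.1.orderEmbOfFin S.2 (I.cons i).b
      a_ne_b := fun h => (I.cons i).a_ne_b ((S.1.orderEmbOfFin S.2).injective h)
      perm := (I.cons i).perm }

/-- The planted instance evaluates the original one on the restriction `x_S`:
`ℑ_S(x) = ℑ(x_S)`. [cite: LeeRaghavendraSteurer2015, Cor 7.7 (arXiv p. 29)] -/
theorem plant_val (I : UGInstance q m) (S : {S : Finset (Fin n) // S.card = m}) (x : Fin n → Fin q) :
    (I.plant S).val x = I.val (restrictFin S x) := rfl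

/-- Planting preserves soundness: `opt(ℑ_S) ≤ s` if `opt(ℑ) ≤ s`. [cite: LeeRaghavendraSteurer2015, Cor 7.7 (arXiv p. 29)] -/
theorem plant_optLE {I : UGInstance q m} {s : ℝ} (h : I.OptLE s)
    (S : {S : Finset (Fin n) // S.card = m}) : (I.plant S).OptLE s :=
  fun x => by rw [plant_val]; exact h _

end UGInstance

/-- The sound instances `{ℑ ∈ UG^q_n : opt(ℑ) ≤ s}` — the row set of `M^{n,UG^q}_{c,s}`.
[cite: LeeRaghavendraSteurer2015, §7.3 (arXiv p. 29)] -/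
def UGSound (q n : ℕ) (s : ℝ) : Type := {I : UGInstance q n // I.OptLE s}

/-- **`M^{n,UG^q}_{c,s}(ℑ, x) = c − ℑ(x)`**, rows: instances with `opt(ℑ) ≤ s`, columns: `x ∈ [q]ⁿ`.
[cite: LeeRaghavendraSteurer2015, §7.3 (arXiv p. 29)] -/
def ugMatrix (q n : ℕ) (c s : ℝ) : UGSound q n s → (Fin n → Fin q) → ℝ :=
  fun I x => c - I.1.val x

/-! ### A sound instance on every `n ≥ 2` variables (all cyclic shifts on one pair) -/

/-- For `q ≥ 1` and `n ≥ 2` there is an instance of `UG^q_n` of value IDENTICALLY `1/q`: the `q`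
constraints `x_1 = x_0 + s`, `s ∈ ℤ/q`, on the pair `(0,1)` — exactly one of them holds for every `x`.
(Used for `nnr(M^{n,UG^q}_{c,s}) ≥ 1`, `n ≥ 2`.) [cite: LeeRaghavendraSteurer2015, Cor 7.7 (arXiv p. 29: "for all n ≥ 1")] -/
theorem exists_ugInstance_val_eq {q n : ℕ} (hq : 1 ≤ q) (hn : 2 ≤ n) :
    ∃ I : UGInstance q n, ∀ x, I.val x = 1 / q := by
  obtain ⟨q', rfl⟩ : ∃ q', q = q' + 1 := ⟨q - 1, by omega⟩
  let a : Fin n := ⟨0, by omega⟩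
  let b : Fin n := ⟨1, by omega⟩
  have hab : a ≠ b := by simp [a, b, Fin.ext_iff]
  refine ⟨⟨q' + 1, Nat.succ_pos _, fun s => ⟨a, b, hab, Equiv.addRight s⟩⟩, fun x => ?_⟩
  simp only [UGInstance.val, UGConstraint.sat, Equiv.coe_addRight, Nat.cast_add, Nat.cast_one]
  congr 1
  have hiff : ∀ s : Fin (q' + 1), (x b = x a + s) ↔ (s = x b - x a) := fun s => by
    constructor
    · intro h; rw [h]; abel
    · intro h; rw [h]; abel
  simp_rw [hiff]
  rw [Finset.sum_ite_eq' univ (x b - x a)]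
  simp

/-- Hence for `c > s ≥ 1/q` and `n ≥ 2` the matrix `M^{n,UG^q}_{c,s}` has a positive entry, so no
nonnegative factorisation of size `0`. [cite: LeeRaghavendraSteurer2015, Cor 7.7 (arXiv p. 29)] -/
theorem not_hasNonnegFactorization_ugMatrix_zero {q n : ℕ} (hq : 1 ≤ q) (hn : 2 ≤ n) {c s : ℝ}
    (hs : 1 / (q : ℝ) ≤ s) (hcs : s < c) : ¬ HasNonnegFactorization (ugMatrix q n c s) 0 := by
  obtain ⟨I, hI⟩ := exists_ugInstance_val_eq hq hn
  rintro ⟨U, V, -, -, hM⟩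
  have hq0 : 0 < q := hq
  let x : Fin n → Fin q := fun _ => ⟨0, hq0⟩
  have h := hM ⟨I, fun y => by rw [hI y]; exact hs⟩ x
  simp only [ugMatrix, univ_eq_empty, sum_empty] at h
  rw [hI x] at h
  linarith

/-! ### The uniform measure on `[q]` and on `[q]ⁿ` -/

/-- The uniform measure on the label set `[q]` ("`μ` as the uniform measure on `[q]`").
[cite: LeeRaghavendraSteurer2015, §7.3 (arXiv p. 29)] -/
def labelWeight (q : ℕ) : Fin q → ℝ := fun _ => 1 / q

/-- It is a probability weight (`q ≥ 1`). [cite: LeeRaghavendraSteurer2015, §7.3 (arXiv p. 29)] -/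
theorem isProbWeight_labelWeight {q : ℕ} (hq : 1 ≤ q) : IsProbWeight (labelWeight q) where
  nonneg _ := by unfold labelWeight; positivity
  sum_eq_one := by
    have : (0 : ℝ) < q := by exact_mod_cast hq
    simp only [labelWeight, sum_const, card_univ, Fintype.card_fin, nsmul_eq_mul]
    field_simp

/-- Its `n`-fold product is the uniform measure on `[q]ⁿ` (the default measure of `d`-local
pseudo-densities). [cite: LeeRaghavendraSteurer2015, §7.1 (arXiv p. 27: "we always refer to the uniform measure by default")] -/
theorem prodWeight_labelWeight (q n : ℕ) :
    prodWeight (labelWeight q) n = uniformWeight (Fin n) (Fin q) := by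
  funext x
  simp [prodWeight, piWeight, labelWeight, uniformWeight, Fintype.card_fin]

/-! ### The Charikar–Makarychev–Makarychev Sherali–Adams gap for Unique Games (named fact) -/

/-- **Charikar–Makarychev–Makarychev 2009, Theorem 6.1 (polynomial-round Sherali–Adams gap for Unique
Games), in the `d`-local pseudo-density currency of Lee–Raghavendra–Steurer's Theorem 7.6:** for every
`t ≥ 1` (`q = 2^t` labels), every `δ ∈ (0,1)` and every `ε > 0` there are `γ > 0` and `n₀` such that for
every `n ≥ n₀` some instance `ℑ ∈ UG^q_n` with `opt(ℑ) ≤ (1 + δ)/q` admits a `⌊n^γ⌋`-local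
pseudo-density `D` (w.r.t. the uniform measure on `[q]ⁿ`) with `E[D·ℑ] ≥ 1 − ε` ("a solution to the LP
relaxation obtained after `r = n^γ` rounds of Sherali–Adams of cost `1 − ε`").  See the module docstring
for the rendering decisions (`Δ`-regularity not typed; round/degree offsets absorbed by `γ`; the
local-distribution ⇒ pseudo-density transfer is the warrant printed by Lee–Raghavendra–Steurer).  NOT
proved here (printed with a proof sketch via CMM Theorem 5.3 for MAX 2LIN).
[cite: CharikarMakarychevMakarychev2009, Thm 6.1 (p. 13)]
[cite: LeeRaghavendraSteurer2015, Thm 7.6 (arXiv p. 29)] -/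
def CharikarMakarychevMakarychev2009_uniqueGamesSA : Prop :=
  ∀ t : ℕ, 1 ≤ t → ∀ δ : ℝ, 0 < δ → δ < 1 → ∀ ε : ℝ, 0 < ε →
    ∃ γ : ℝ, 0 < γ ∧ ∃ n₀ : ℕ, ∀ n : ℕ, n₀ ≤ n →
      ∃ I : UGInstance (2 ^ t) n, I.OptLE ((1 + δ) / 2 ^ t) ∧
        ∃ D : (Fin n → Fin (2 ^ t)) → ℝ,
          IsLocalPseudoDensity (uniformWeight (Fin n) (Fin (2 ^ t))) ⌊(n : ℝ) ^ γ⌋₊ D ∧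
          1 - ε ≤ muExpect (uniformWeight (Fin n) (Fin (2 ^ t))) (fun x => D x * I.val x)

/-! ### Witnessing a lower bound on the approximate junta degree -/

/-- **Lower bounds on `juntadeg^ε` from a witness:** for `f ≥ 0`, nonnegative weights and `ε ≥ 0`, a
`d`-local pseudo-density `D` with `E_μ[D f] < −ε‖D‖_∞ E_μ f` shows `juntadeg^ε(f; μ) ≥ d + 1` (the set in
eq. (7.1) is bounded: a `d`-local pseudo-density with `d ≥ |ι|` is nonnegative against every nonnegative
function). [cite: LeeRaghavendraSteurer2015, §7.1 (arXiv p. 27, eq. (7.1))] -/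
theorem add_one_le_approxJuntaDegree {ι X : Type*} [Fintype ι] [DecidableEq ι] [Fintype X]
    {ε : ℝ} (hε : 0 ≤ ε) {μ : (ι → X) → ℝ} (hμ : ∀ x, 0 ≤ μ x) {f : (ι → X) → ℝ} (hf : ∀ x, 0 ≤ f x)
    {d : ℕ} {D : (ι → X) → ℝ} (hD : IsLocalPseudoDensity μ d D)
    (hDf : muExpect μ (fun x => D x * f x) < -(ε * ‖D‖ * muExpect μ f)) :
    d + 1 ≤ approxJuntaDegree ε μ f := by
  unfold approxJuntaDegree
  set s := {d' | ∃ d : ℕ, d' = d + 1 ∧ ∃ D : (ι → X) → ℝ, IsLocalPseudoDensity μ d D ∧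
    muExpect μ (fun x => D x * f x) < -(ε * ‖D‖ * muExpect μ f)} with hs
  have hmem : d + 1 ∈ s := ⟨d, rfl, D, hD, hDf⟩
  have hbdd : BddAbove s := by
    refine ⟨Fintype.card ι + 1, fun d' hd' => ?_⟩
    obtain ⟨d₁, rfl, D₁, hD₁, hD₁f⟩ := hd'
    by_contra hlt
    have hmd : Fintype.card ι ≤ d₁ := by omega
    have hfj : IsKJunta d₁ f :=
      ⟨univ, by rw [card_univ]; exact hmd,
        fun x y hxy => by rw [show x = y from funext fun i => hxy i (mem_univ i)]⟩
    have h0 := hD₁.2 _ hfj hf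
    have hEf : 0 ≤ muExpect μ f := sum_nonneg fun x _ => mul_nonneg (hμ x) (hf x)
    have hpos : 0 ≤ ε * ‖D₁‖ * muExpect μ f := mul_nonneg (mul_nonneg hε (norm_nonneg _)) hEf
    linarith
  exact le_csSup hbdd hmem

/-! ### Theorem 7.6 from the CMM gap -/

/-- **Lee–Raghavendra–Steurer 2015, Theorem 7.6 (from [CharikarMakarychevMakarychev2009]), in the form
the citation delivers:** for `t ≥ 1` (`q = 2^t`) and `0 < δ ≤ 1/4` there are `γ > 0` and `m₀` such that
for every `m ≥ m₀` there are `ε > 0` and an instance `ℑ ∈ UG^q_m` with `opt(ℑ) ≤ 1/q + δ` but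
`juntadeg^ε(1 − δ − ℑ; μ^m) > m^γ` (`μ` uniform on `[q]`).  Proof: the CMM gap at `(δ, ε' = δ/2)` gives
`opt ≤ (1+δ)/q ≤ 1/q + δ` and a `⌊m^γ⌋`-local `D` with `E[D ℑ] ≥ 1 − δ/2`, so
`E[D(1−δ−ℑ)] = 1 − δ − E[Dℑ] ≤ −δ/2 < −ε‖D‖_∞E[1−δ−ℑ]` for `ε = δ/(4(‖D‖_∞‖1−δ−ℑ‖₁ + 1))`; hence
`juntadeg^ε ≥ ⌊m^γ⌋ + 1 > m^γ`. [cite: LeeRaghavendraSteurer2015, Thm 7.6 (arXiv p. 29)]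
[cite: CharikarMakarychevMakarychev2009, Thm 6.1 (p. 13)] -/
theorem LeeRaghavendraSteurer2015_thm76 (hCMM : CharikarMakarychevMakarychev2009_uniqueGamesSA)
    {t : ℕ} (ht : 1 ≤ t) {δ : ℝ} (hδ : 0 < δ) (hδ4 : δ ≤ 1 / 4) :
    ∃ γ : ℝ, 0 < γ ∧ ∃ m₀ : ℕ, ∀ m : ℕ, m₀ ≤ m → ∃ ε : ℝ, 0 < ε ∧
      ∃ I : UGInstance (2 ^ t) m, I.OptLE (1 / 2 ^ t + δ) ∧
        (m : ℝ) ^ γ < approxJuntaDegree ε (prodWeight (labelWeight (2 ^ t)) m)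
          (fun x => 1 - δ - I.val x) := by
  obtain ⟨γ, hγ, n₀, hn₀⟩ := hCMM t ht δ hδ (by linarith) (δ / 2) (by positivity)
  refine ⟨γ, hγ, n₀, fun m hm => ?_⟩
  obtain ⟨I, hI, D, hD, hDval⟩ := hn₀ m hm
  -- `q = 2^t ≥ 2`
  have h2t : (2 : ℝ) ≤ (2 : ℝ) ^ t := by
    calc (2 : ℝ) = 2 ^ 1 := by norm_num
      _ ≤ 2 ^ t := pow_le_pow_right₀ (by norm_num) ht
  have hq0 : (0 : ℝ) < (2 : ℝ) ^ t := by positivity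
  have hq1 : 1 ≤ 2 ^ t := Nat.one_le_two_pow
  set μ := prodWeight (labelWeight (2 ^ t)) m with hμdef
  have hμu : μ = uniformWeight (Fin m) (Fin (2 ^ t)) := prodWeight_labelWeight (2 ^ t) m
  have hμ : IsProbWeight μ := isProbWeight_piWeight (isProbWeight_labelWeight hq1)
  rw [← hμu] at hD hDval
  -- soundness `opt ≤ (1+δ)/q ≤ 1/q + δ`
  have hsound : I.OptLE (1 / (2 : ℝ) ^ t + δ) := by
    refine hI.mono ?_
    rw [add_div]
    gcongr
    rw [div_le_iff₀ hq0]
    nlinarith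
  -- the function `f = 1 − δ − ℑ ≥ 0`
  set f : (Fin m → Fin (2 ^ t)) → ℝ := fun x => 1 - δ - I.val x with hfdef
  have hf : ∀ x, 0 ≤ f x := by
    intro x
    have h1 : I.val x ≤ (1 + δ) / (2 : ℝ) ^ t := hI x
    have h2 : (1 + δ) / (2 : ℝ) ^ t ≤ (1 + δ) / 2 :=
      div_le_div_of_nonneg_left (by linarith) (by norm_num) h2t
    simp only [hfdef]
    linarith
  -- `E[D f] = (1 − δ) E[D] − E[D ℑ] ≤ −δ/2`
  have hEDf : muExpect μ (fun x => D x * f x) ≤ -(δ / 2) := by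
    have hsplit : muExpect μ (fun x => D x * f x) =
        (1 - δ) * muExpect μ D - muExpect μ (fun x => D x * I.val x) := by
      simp only [muExpect, hfdef, mul_sum, ← sum_sub_distrib]
      refine sum_congr rfl fun x _ => ?_
      ring
    rw [hsplit, hD.1]
    linarith
  -- the choice of `ε`
  set F := muExpect μ f with hF
  have hF0 : 0 ≤ F := hμ.muExpect_nonneg hf
  have hDF0 : 0 ≤ ‖D‖ * F := mul_nonneg (norm_nonneg _) hF0
  set ε : ℝ := δ / (4 * (‖D‖ * F + 1)) with hεdef
  have hε : 0 < ε := by rw [hεdef]; positivity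
  have hεDF : ε * ‖D‖ * F < δ / 2 := by
    have h1 : ε * ‖D‖ * F = δ / 4 * (‖D‖ * F / (‖D‖ * F + 1)) := by
      rw [hεdef]; field_simp
    have h2 : ‖D‖ * F / (‖D‖ * F + 1) ≤ 1 := by
      rw [div_le_one (by positivity)]; linarith
    rw [h1]
    nlinarith
  have hDf : muExpect μ (fun x => D x * f x) < -(ε * ‖D‖ * muExpect μ f) := by
    rw [← hF]; linarith
  refine ⟨ε, hε, I, hsound, ?_⟩
  have hdeg := add_one_le_approxJuntaDegree hε.le hμ.nonneg hf hD hDf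
  calc ((m : ℝ) ^ γ) < (⌊(m : ℝ) ^ γ⌋₊ : ℕ) + 1 := Nat.lt_floor_add_one _
    _ = ((⌊(m : ℝ) ^ γ⌋₊ + 1 : ℕ) : ℝ) := by push_cast; ring
    _ ≤ (approxJuntaDegree ε μ f : ℝ) := by exact_mod_cast hdeg

/-- **Theorem 7.6 with the printed quantifiers** ("there exist `γ, ε > 0`, an `m ≥ 1`, and an instance
`ℑ ∈ UG^q_m` such that `opt(ℑ) ≤ 1/q + δ`, but `juntadeg^ε(1 − δ − ℑ) ≥ m^γ`"), `0 < δ ≤ 1/4`.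
[cite: LeeRaghavendraSteurer2015, Thm 7.6 (arXiv p. 29)] -/
theorem LeeRaghavendraSteurer2015_thm76_literal (hCMM : CharikarMakarychevMakarychev2009_uniqueGamesSA)
    {t : ℕ} (ht : 1 ≤ t) {δ : ℝ} (hδ : 0 < δ) (hδ4 : δ ≤ 1 / 4) :
    ∃ γ ε : ℝ, 0 < γ ∧ 0 < ε ∧ ∃ m : ℕ, 1 ≤ m ∧
      ∃ I : UGInstance (2 ^ t) m, I.OptLE (1 / 2 ^ t + δ) ∧
        (m : ℝ) ^ γ ≤ approxJuntaDegree ε (prodWeight (labelWeight (2 ^ t)) m)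
          (fun x => 1 - δ - I.val x) := by
  obtain ⟨γ, hγ, m₀, hm₀⟩ := LeeRaghavendraSteurer2015_thm76 hCMM ht hδ hδ4
  obtain ⟨ε, hε, I, hI, hdeg⟩ := hm₀ (max m₀ 1) (le_max_left _ _)
  exact ⟨γ, ε, hγ, hε, max m₀ 1, le_max_right _ _, I, hI, hdeg.le⟩

/-! ### `M_n^f` is a submatrix of `M^{n,UG^q}_{c,s}` (planting) -/

/-- **Planting:** for a sound instance `ℑ ∈ UG^q_m` (`opt(ℑ) ≤ s`), the pattern matrix `M_n^f` of
`f = c − ℑ` (rows `S ∈ ([n] choose m)`, columns `x ∈ [q]ⁿ`, entry `c − ℑ(x_S) = c − ℑ_S(x)`) is the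
submatrix of `M^{n,UG^q}_{c,s}` on the rows of the planted instances `ℑ_S`; so
`nnr(M^{n,UG^q}_{c,s}) ≥ nnr(M_n^f)` (via the tree's `HasNonnegFactorization.submatrix`).
[cite: LeeRaghavendraSteurer2015, Cor 7.7 (arXiv p. 29)] -/
theorem hasNonnegFactorization_generalPatternMatrix_of_ugMatrix {q m n : ℕ} {c s : ℝ}
    (I : UGInstance q m) (hI : I.OptLE s) {r : ℕ} (h : HasNonnegFactorization (ugMatrix q n c s) r) :
    HasNonnegFactorization (generalPatternMatrix n (fun y => c - I.val y)) r := by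
  have h' := h.submatrix (fun S : {S : Finset (Fin n) // S.card = m} =>
    (⟨I.plant S, UGInstance.plant_optLE hI S⟩ : UGSound q n s)) id
  have hfun : (fun (S : {S : Finset (Fin n) // S.card = m}) (x : Fin n → Fin q) =>
      ugMatrix q n c s ⟨I.plant S, UGInstance.plant_optLE hI S⟩ (id x)) =
      generalPatternMatrix n (fun y => c - I.val y) := by
    funext S x
    simp [ugMatrix, generalPatternMatrix, UGInstance.plant_val]
  rw [hfun] at h'
  exact h'

/-! ### Corollary 7.7 (appended part; proofs only) -/

/-- Variant of `not_hasNonnegFactorization_ugMatrix_zero` with the hypotheses `s ≥ 1/q`, `c > 1/q`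
(the all-shifts instance has value `≡ 1/q`, so its row of `M^{n,UG^q}_{c,s}` is the positive constant
`c − 1/q`): `nnr(M^{n,UG^q}_{c,s}) ≥ 1` for `n ≥ 2`. [cite: LeeRaghavendraSteurer2015, Cor 7.7 (arXiv p. 29)] -/
theorem not_hasNonnegFactorization_ugMatrix_zero' {q n : ℕ} (hq : 1 ≤ q) (hn : 2 ≤ n) {c s : ℝ}
    (hs : 1 / (q : ℝ) ≤ s) (hc : 1 / (q : ℝ) < c) : ¬ HasNonnegFactorization (ugMatrix q n c s) 0 := by
  obtain ⟨I, hI⟩ := exists_ugInstance_val_eq hq hn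
  rintro ⟨U, V, -, -, hM⟩
  have hq0 : 0 < q := hq
  let x : Fin n → Fin q := fun _ => ⟨0, hq0⟩
  have h := hM ⟨I, fun y => by rw [hI y]; exact hs⟩ x
  simp only [ugMatrix, univ_eq_empty, sum_empty] at h
  rw [hI x] at h
  linarith

/-- `(log x)^{d+1} ≤ (d+1)^{d+1} · x` for `x ≥ 1` (from `log x ≤ x^{1/(d+1)}·(d+1)`): the polylogarithmic
loss of Theorem 7.2 against one power of `n`. [cite: LeeRaghavendraSteurer2015, Cor 7.7 (arXiv p. 29: "≥ c n^d")] -/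
private theorem log_pow_succ_le {x : ℝ} (hx : 1 ≤ x) (d : ℕ) :
    Real.log x ^ (d + 1) ≤ ((d : ℝ) + 1) ^ (d + 1) * x := by
  have hx0 : 0 ≤ x := by linarith
  have hd1 : (0 : ℝ) < (d : ℝ) + 1 := by positivity
  have hlog0 : 0 ≤ Real.log x := Real.log_nonneg hx
  have h1 : Real.log x ≤ ((d : ℝ) + 1) * x ^ (1 / ((d : ℝ) + 1)) := by
    have h := Real.log_le_rpow_div hx0 (one_div_pos.mpr hd1)
    rw [div_div_eq_mul_div, div_one] at h
    linarith [h]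
  have hrpow0 : 0 ≤ x ^ (1 / ((d : ℝ) + 1)) := Real.rpow_nonneg hx0 _
  calc Real.log x ^ (d + 1) ≤ (((d : ℝ) + 1) * x ^ (1 / ((d : ℝ) + 1))) ^ (d + 1) :=
        pow_le_pow_left₀ hlog0 h1 _
    _ = ((d : ℝ) + 1) ^ (d + 1) * (x ^ (1 / ((d : ℝ) + 1))) ^ (d + 1) := mul_pow _ _ _
    _ = ((d : ℝ) + 1) ^ (d + 1) * x := by
        congr 1
        rw [← Real.rpow_natCast, ← Real.rpow_mul hx0]
        push_cast
        rw [one_div_mul_cancel hd1.ne', Real.rpow_one]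

/-- `(A/(B(d+1)))^{d+1} · x^d ≤ (A x/(B log x))^{d+1}` for `x > 1`: the bound of Theorem 7.2 in the
second regime dominates `c·x^d`. [cite: LeeRaghavendraSteurer2015, Cor 7.7 (arXiv p. 29)] -/
private theorem pow_mul_le_div_log_pow {A B x : ℝ} (hA : 0 ≤ A) (hB : 0 < B) (hx : 1 ≤ x)
    (hlog : 0 < Real.log x) (d : ℕ) :
    (A / (B * ((d : ℝ) + 1))) ^ (d + 1) * x ^ d ≤ (A * x / (B * Real.log x)) ^ (d + 1) := by
  have hx0 : 0 < x := by linarith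
  have hd1 : (0 : ℝ) < (d : ℝ) + 1 := by positivity
  have hlp := log_pow_succ_le hx d
  rw [div_pow, div_pow, mul_pow, mul_pow, mul_pow, div_mul_eq_mul_div,
    div_le_div_iff₀ (by positivity) (by positivity)]
  have h1 : A ^ (d + 1) * x ^ d * (B ^ (d + 1) * Real.log x ^ (d + 1)) =
      (A ^ (d + 1) * B ^ (d + 1) * x ^ d) * Real.log x ^ (d + 1) := by ring
  have h2 : A ^ (d + 1) * x ^ (d + 1) * (B ^ (d + 1) * ((d : ℝ) + 1) ^ (d + 1)) =
      (A ^ (d + 1) * B ^ (d + 1) * x ^ d) * (((d : ℝ) + 1) ^ (d + 1) * x) := by ring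
  rw [h1, h2]
  exact mul_le_mul_of_nonneg_left hlp (by positivity)

/-- **Lee–Raghavendra–Steurer 2015, Corollary 7.7 (Unique Games hardness for LPs), PROVED from the
Charikar–Makarychev–Makarychev gap:** for every `t ≥ 1` (`q = 2^t`), `0 < δ ≤ 1/4` and `d` there is a
constant `c > 0` such that for all `n ≥ 2`, `nnr(M^{n,UG^q}_{1−δ, 1/q+δ}) ≥ c·n^d` — every nonnegative
factorisation of `M^{n,UG^q}_{1−δ,1/q+δ}` has size `r ≥ c·n^d`; "polynomial-size families of LP
relaxations cannot achieve a `(1−δ, 1/q+δ)`-approximation for the Unique Games problem".  Proof (the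
printed one, made explicit): Theorem 7.6 with `m` so large that `m^γ ≥ d` gives `ℑ ∈ UG^q_m`,
`opt(ℑ) ≤ 1/q + δ`, and a `d`-local pseudo-density witnessing `juntadeg^ε(f; μ^m) ≥ d + 1`,
`f = 1 − δ − ℑ ≥ 0`; for `n ≥ 2m` the pattern matrix `M_n^f` is a submatrix (planting), so Theorem 7.2
(`LeeRaghavendraSteurer2015_thm72_lower'`) gives `r ≥ n^{d+1}` or
`r > (ε/3)(ε²n/(48m²((d+1)log n + log(‖f‖_∞/‖f‖₁) + log(3/ε))))^{d+1} ≥ (ε/3)(ε²/(96m²(d+1)²))^{d+1}n^d`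
once `(d+1) log n ≥ log(‖f‖_∞/‖f‖₁) + log(3/ε)` (using `(log n)^{d+1} ≤ (d+1)^{d+1} n`); smaller `n ≥ 2`
are covered by `nnr ≥ 1` and the factor `1/N^d` in `c`.  See the module docstring for `n ≥ 2` (vs the
printed `n ≥ 1`) and `δ ≤ 1/4`. [cite: LeeRaghavendraSteurer2015, Cor 7.7 (arXiv p. 29)]
[cite: CharikarMakarychevMakarychev2009, Thm 6.1 (p. 13)] -/
theorem LeeRaghavendraSteurer2015_cor77 (hCMM : CharikarMakarychevMakarychev2009_uniqueGamesSA)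
    {t : ℕ} (ht : 1 ≤ t) {δ : ℝ} (hδ : 0 < δ) (hδ4 : δ ≤ 1 / 4) (d : ℕ) :
    ∃ c : ℝ, 0 < c ∧ ∀ n : ℕ, 2 ≤ n → ∀ r : ℕ,
      HasNonnegFactorization (ugMatrix (2 ^ t) n (1 - δ) (1 / 2 ^ t + δ)) r → c * (n : ℝ) ^ d ≤ r := by
  obtain ⟨γ, hγ, m₀, hm₀⟩ := LeeRaghavendraSteurer2015_thm76 hCMM ht hδ hδ4
  -- basic facts about `q = 2^t`
  have h2t : (2 : ℝ) ≤ (2 : ℝ) ^ t := by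
    calc (2 : ℝ) = 2 ^ 1 := by norm_num
      _ ≤ 2 ^ t := pow_le_pow_right₀ (by norm_num) ht
  have hq0 : (0 : ℝ) < (2 : ℝ) ^ t := by positivity
  have hq1 : 1 ≤ 2 ^ t := Nat.one_le_two_pow
  have hμ : IsProbWeight (labelWeight (2 ^ t)) := isProbWeight_labelWeight hq1
  have hqinv : 1 / (2 : ℝ) ^ t ≤ 1 / 2 := div_le_div_of_nonneg_left (by norm_num) (by norm_num) h2t
  -- an `m ≥ m₀` with `m^γ ≥ d`
  set m : ℕ := max m₀ (⌈(d : ℝ) ^ (1 / γ)⌉₊ + 1) with hmdef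
  have hm₀m : m₀ ≤ m := le_max_left _ _
  have hmγ : (d : ℝ) ≤ (m : ℝ) ^ γ := by
    have h1 : (d : ℝ) ^ (1 / γ) ≤ m := by
      calc (d : ℝ) ^ (1 / γ) ≤ ⌈(d : ℝ) ^ (1 / γ)⌉₊ := Nat.le_ceil _
        _ ≤ ((⌈(d : ℝ) ^ (1 / γ)⌉₊ + 1 : ℕ) : ℝ) := by push_cast; linarith
        _ ≤ m := by exact_mod_cast le_max_right _ _
    calc (d : ℝ) = ((d : ℝ) ^ (1 / γ)) ^ γ := by
          rw [← Real.rpow_mul (Nat.cast_nonneg _), one_div_mul_cancel hγ.ne', Real.rpow_one]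
      _ ≤ (m : ℝ) ^ γ := Real.rpow_le_rpow (by positivity) h1 hγ.le
  obtain ⟨ε, hε, I, hI, hdeg⟩ := hm₀ m hm₀m
  -- `f = 1 − δ − ℑ ≥ 0` and a `d`-local witness of `juntadeg^ε(f) ≥ d + 1`
  set f : (Fin m → Fin (2 ^ t)) → ℝ := fun x => 1 - δ - I.val x with hfdef
  have hf : ∀ x, 0 ≤ f x := by
    intro x
    have h1 : I.val x ≤ 1 / (2 : ℝ) ^ t + δ := hI x
    simp only [hfdef]
    linarith
  have hdA : d < approxJuntaDegree ε (prodWeight (labelWeight (2 ^ t)) m) f := by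
    have : (d : ℝ) < (approxJuntaDegree ε (prodWeight (labelWeight (2 ^ t)) m) f : ℝ) :=
      hmγ.trans_lt hdeg
    exact_mod_cast this
  obtain ⟨D, hD, hDf⟩ := exists_pseudoDensity_of_lt_approxJuntaDegree hdA
  obtain ⟨hF₁pos, hDpos, hε1, hm0, hfF⟩ := thm72_hypothesis_pos hμ hf hε hD hDf
  set F₁ := muExpect (prodWeight (labelWeight (2 ^ t)) m) f with hF₁
  have hm0' : (0 : ℝ) < m := by exact_mod_cast hm0
  -- constants
  set K₂ : ℝ := Real.log (‖f‖ / F₁) + Real.log (3 / ε) with hK₂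
  have hK₂0 : 0 ≤ K₂ := by
    have h1 : 0 ≤ Real.log (‖f‖ / F₁) := Real.log_nonneg (by rw [le_div_iff₀ hF₁pos]; linarith)
    have h2 : 0 ≤ Real.log (3 / ε) := Real.log_nonneg (by rw [le_div_iff₀ hε]; linarith)
    rw [hK₂]; linarith
  set K₃ : ℝ := (ε ^ 2 / (96 * (m : ℝ) ^ 2 * ((d : ℝ) + 1) * ((d : ℝ) + 1))) ^ (d + 1) with hK₃
  have hK₃0 : 0 < K₃ := by rw [hK₃]; positivity
  set c₁ : ℝ := min 1 (ε / 3 * K₃) with hc₁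
  have hc₁0 : 0 < c₁ := lt_min one_pos (by positivity)
  have hc₁1 : c₁ ≤ 1 := min_le_left _ _
  set N : ℕ := max (2 * m) (max 3 ⌈Real.exp (K₂ / ((d : ℝ) + 1))⌉₊) with hN
  have hN0 : (0 : ℝ) < N := by
    have : 3 ≤ N := le_trans (le_max_left _ _) (le_max_right _ _)
    exact_mod_cast (by omega : 0 < N)
  refine ⟨min c₁ (1 / (N : ℝ) ^ d), lt_min hc₁0 (by positivity), fun n hn r hr => ?_⟩
  have hn0 : (0 : ℝ) ≤ n := Nat.cast_nonneg _
  by_cases hnN : N ≤ n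
  · -- large `n`: Theorem 7.2 on the planted submatrix
    have h2m : 2 * m ≤ n := le_trans (le_max_left _ _) hnN
    have hn3 : 3 ≤ n := le_trans (le_trans (le_max_left _ _) (le_max_right _ _)) hnN
    have hnexp : ⌈Real.exp (K₂ / ((d : ℝ) + 1))⌉₊ ≤ n :=
      le_trans (le_trans (le_max_right _ _) (le_max_right _ _)) hnN
    have hn1 : (1 : ℝ) ≤ n := by exact_mod_cast (by omega : 1 ≤ n)
    have hn3' : (3 : ℝ) ≤ n := by exact_mod_cast hn3
    have hr' := hasNonnegFactorization_generalPatternMatrix_of_ugMatrix I hI hr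
    have hmain := LeeRaghavendraSteurer2015_thm72_lower' hμ h2m hf hε hD hDf hr'
    have hgoal : c₁ * (n : ℝ) ^ d ≤ r := by
      rcases hmain with h | h
      · -- first regime: `r ≥ n^{d+1} ≥ n^d`
        calc c₁ * (n : ℝ) ^ d ≤ 1 * (n : ℝ) ^ d := by gcongr
          _ ≤ (n : ℝ) ^ (d + 1) := by rw [one_mul, pow_succ]; exact le_mul_of_one_le_right (by positivity) hn1
          _ ≤ r := h
      · -- second regime
        -- `log n ≥ 1` and `(d+1) log n ≥ K₂`
        have hlogn : 1 ≤ Real.log n := by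
          rw [Real.le_log_iff_exp_le (by linarith)]
          have := Real.exp_one_lt_d9
          linarith
        have hlogK : K₂ ≤ ((d : ℝ) + 1) * Real.log n := by
          have hd1 : (0 : ℝ) < (d : ℝ) + 1 := by positivity
          have h1 : Real.exp (K₂ / ((d : ℝ) + 1)) ≤ n :=
            le_trans (Nat.le_ceil _) (by exact_mod_cast hnexp)
          have h2 : K₂ / ((d : ℝ) + 1) ≤ Real.log n := by
            rw [← Real.log_exp (K₂ / ((d : ℝ) + 1))]
            exact Real.log_le_log (Real.exp_pos _) h1
          rwa [div_le_iff₀ hd1, mul_comm] at h2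
        set L : ℝ := ((d : ℝ) + 1) * Real.log n + Real.log (‖f‖ / F₁) + Real.log (3 / ε) with hL
        have hLle : L ≤ 2 * (((d : ℝ) + 1) * Real.log n) := by rw [hL]; linarith
        have hLpos : 0 < L := by
          rw [hL]
          have : 0 < ((d : ℝ) + 1) * Real.log n := by positivity
          linarith
        -- the smaller base `ε² n/(96 m² (d+1) log n)`
        have hbase : ε ^ 2 * n / (96 * (m : ℝ) ^ 2 * ((d : ℝ) + 1) * Real.log n) ≤
            ε ^ 2 * n / (48 * (m : ℝ) ^ 2 * L) := by
          apply div_le_div_of_nonneg_left (by positivity) (by positivity)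
          calc 48 * (m : ℝ) ^ 2 * L ≤ 48 * (m : ℝ) ^ 2 * (2 * (((d : ℝ) + 1) * Real.log n)) := by
                gcongr
            _ = 96 * (m : ℝ) ^ 2 * ((d : ℝ) + 1) * Real.log n := by ring
        have hbase0 : 0 ≤ ε ^ 2 * n / (96 * (m : ℝ) ^ 2 * ((d : ℝ) + 1) * Real.log n) := by
          positivity
        have hK₃n : K₃ * (n : ℝ) ^ d ≤
            (ε ^ 2 * n / (96 * (m : ℝ) ^ 2 * ((d : ℝ) + 1) * Real.log n)) ^ (d + 1) := by
          have h := pow_mul_le_div_log_pow (A := ε ^ 2) (B := 96 * (m : ℝ) ^ 2 * ((d : ℝ) + 1))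
            (by positivity) (by positivity) hn1 (by linarith) d
          rw [hK₃]
          convert h using 2
        calc c₁ * (n : ℝ) ^ d ≤ (ε / 3 * K₃) * (n : ℝ) ^ d := by
              gcongr; exact min_le_right _ _
          _ = ε / 3 * (K₃ * (n : ℝ) ^ d) := by ring
          _ ≤ ε / 3 * (ε ^ 2 * n / (96 * (m : ℝ) ^ 2 * ((d : ℝ) + 1) * Real.log n)) ^ (d + 1) := by
              gcongr
          _ ≤ ε / 3 * (ε ^ 2 * n / (48 * (m : ℝ) ^ 2 * L)) ^ (d + 1) := by
              gcongr
          _ ≤ r := by rw [hL]; exact h.le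
    calc min c₁ (1 / (N : ℝ) ^ d) * (n : ℝ) ^ d ≤ c₁ * (n : ℝ) ^ d := by
          gcongr; exact min_le_left _ _
      _ ≤ r := hgoal
  · -- small `n`: `2 ≤ n < N`, `nnr ≥ 1`
    push Not at hnN
    have hr0 : r ≠ 0 := by
      rintro rfl
      refine not_hasNonnegFactorization_ugMatrix_zero' hq1 hn ?_ ?_ hr
      · push_cast; linarith
      · push_cast; linarith
    have hr1 : (1 : ℝ) ≤ r := by exact_mod_cast Nat.one_le_iff_ne_zero.mpr hr0
    have hnN' : (n : ℝ) ≤ N := by exact_mod_cast hnN.le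
    calc min c₁ (1 / (N : ℝ) ^ d) * (n : ℝ) ^ d ≤ (1 / (N : ℝ) ^ d) * (n : ℝ) ^ d := by
          gcongr; exact min_le_right _ _
      _ ≤ (1 / (N : ℝ) ^ d) * (N : ℝ) ^ d := by gcongr
      _ = 1 := by field_simp
      _ ≤ r := hr1

/-! ### The CMM gap in its printed local-distribution form implies the typed fact (appended part) -/

/-- The **local probability of a Unique Games constraint** under a family of local distributions:
`Σ_i x_{ab}(i, π(i)) = Pr_{D_{{a,b}}}[x_b = π(x_a)]` — the summand of the Sherali–Adams objective
"`Σ_{(u,v) ∈ E} Σ_{i ∈ S} x_{uv}(i π_{uv}(i))`" with "`x_{uv}(ij)` the probability that `u` has label `i`,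
and `v` has label `j`". [cite: CharikarMakarychevMakarychev2009, §6 (p. 13)] -/
def UGConstraint.localProb {q n d : ℕ} (C : UGConstraint q n)
    (ℒ : LocalExpectationsOn (Fin n) (Fin q) d) : ℝ :=
  ℒ.L {C.a, C.b} (fun b => if b ⟨C.b, by simp⟩ = C.perm (b ⟨C.a, by simp⟩) then (1 : ℝ) else 0)

/-- The **Sherali–Adams value of an instance under a family of local distributions** (normalised as a
fraction, like `ℑ(x)`): `(1/M) Σ_i Pr_{D_{{a_i,b_i}}}[x_{b_i} = π_i(x_{a_i})]` — CMM's LP objective "the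
number of satisfied constraints `Σ_{(u,v)∈E} Σ_{i∈S} x_{uv}(i π_{uv}(i))`" divided by `M`.
[cite: CharikarMakarychevMakarychev2009, §6 (p. 13)] -/
def UGInstance.localValue {q n d : ℕ} (I : UGInstance q n)
    (ℒ : LocalExpectationsOn (Fin n) (Fin q) d) : ℝ :=
  (∑ i, (I.cons i).localProb ℒ) / I.M

/-- The satisfaction indicator of a constraint is a junta on its two variables.
[cite: CharikarMakarychevMakarychev2009, §6 (p. 13)] -/
theorem UGConstraint.isSJunta_sat {q n : ℕ} (C : UGConstraint q n) :
    IsSJunta ({C.a, C.b} : Finset (Fin n)) (fun x : Fin n → Fin q => if C.sat x then (1 : ℝ) else 0) := by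
  intro x y hxy
  have ha : x C.a = y C.a := hxy C.a (by simp)
  have hb : x C.b = y C.b := hxy C.b (by simp)
  simp only [UGConstraint.sat, ha, hb]

/-- Against the pseudo-density of a consistent family (level `d ≥ 2`), the satisfaction indicator of a
constraint integrates to its local probability: `E_x[D(x) 𝟙[x_b = π(x_a)]] = Pr_{D_{{a,b}}}[x_b = π(x_a)]`.
[cite: CharikarMakarychevMakarychev2009, Lemma 2.1 (p. 4–5) and §6 (p. 13)] -/
theorem UGConstraint.muExpect_density_mul_sat {q n d : ℕ} (C : UGConstraint q n)
    (ℒ : LocalExpectationsOn (Fin n) (Fin q) d) (hd : 2 ≤ d) (x₀ : Fin q) :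
    muExpect (uniformWeight (Fin n) (Fin q))
        (fun x => ℒ.density x₀ x * (if C.sat x then (1 : ℝ) else 0)) = C.localProb ℒ := by
  have hcard : ({C.a, C.b} : Finset (Fin n)).card ≤ d := by
    rw [card_pair C.a_ne_b]; exact hd
  rw [ℒ.muExpect_density_mul_of_isSJunta x₀ hcard C.isSJunta_sat, UGConstraint.localProb]
  congr 1
  funext b
  have ha : C.a ∈ ({C.a, C.b} : Finset (Fin n)) := by simp
  have hb : C.b ∈ ({C.a, C.b} : Finset (Fin n)) := by simp
  simp only [UGConstraint.sat, extendWith, dif_pos ha, dif_pos hb]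

/-- **`E_x[D(x) ℑ(x)]` is the Sherali–Adams value of `ℑ` under the family** (level `d ≥ 2`).
[cite: CharikarMakarychevMakarychev2009, Lemma 2.1 (p. 4–5) and §6 (p. 13)] -/
theorem UGInstance.muExpect_density_mul_val {q n d : ℕ} (I : UGInstance q n)
    (ℒ : LocalExpectationsOn (Fin n) (Fin q) d) (hd : 2 ≤ d) (x₀ : Fin q) :
    muExpect (uniformWeight (Fin n) (Fin q)) (fun x => ℒ.density x₀ x * I.val x) = I.localValue ℒ := by
  set μ := uniformWeight (Fin n) (Fin q) with hμ
  set s : Fin I.M → (Fin n → Fin q) → ℝ := fun i x => if (I.cons i).sat x then (1 : ℝ) else 0 with hs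
  have hval : ∀ x, I.val x = (∑ i, s i x) / (I.M : ℝ) := fun x => rfl
  have hlin : muExpect μ (fun x => ℒ.density x₀ x * I.val x) =
      (∑ i, muExpect μ (fun x => ℒ.density x₀ x * s i x)) / (I.M : ℝ) := by
    simp only [muExpect, hval]
    have e1 : ∀ x, μ x * (ℒ.density x₀ x * ((∑ i, s i x) / (I.M : ℝ))) =
        ∑ i, μ x * (ℒ.density x₀ x * s i x) / (I.M : ℝ) := by
      intro x
      rw [← sum_div, ← mul_sum, ← mul_sum]
      ring
    simp_rw [e1]
    simp only [← sum_div]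
    rw [sum_comm]
  rw [hlin, UGInstance.localValue]
  congr 1
  refine sum_congr rfl fun i _ => ?_
  exact (I.cons i).muExpect_density_mul_sat ℒ hd x₀

/-- **Charikar–Makarychev–Makarychev's Theorem 6.1 in its printed local-distribution form implies the
typed fact.**  If for every `t ≥ 1`, `δ ∈ (0,1)`, `ε > 0` there are `γ > 0`, `n₀` such that for all
`n ≥ n₀` some `ℑ ∈ UG^q_n` (`q = 2^t`) with `opt(ℑ) ≤ (1+δ)/q` carries CONSISTENT LOCAL DISTRIBUTIONS on
all vertex sets of size `≤ ⌊n^γ⌋` ("for every set of vertices `S` of size at most `O(r)` there exists a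
distribution of integral solutions `D_S` … for every two sets `S ⊂ T` the distributions coincide on
`S`") of Sherali–Adams value `≥ 1 − ε` ("a solution to the LP relaxation … of cost `1 − ε`"), then
`CharikarMakarychevMakarychev2009_uniqueGamesSA` holds — via the general-alphabet Lemma 2.1
(`LocalExpectationsOn.isLocalPseudoDensity_density`): the family's pseudo-density is `⌊n^γ⌋`-local and
integrates `ℑ` to the Sherali–Adams value (for `n` large enough that `⌊n^γ⌋ ≥ 2`).
[cite: CharikarMakarychevMakarychev2009, Thm 6.1 and §6 (p. 13), Lemma 2.1 (p. 4–5)]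
[cite: LeeRaghavendraSteurer2015, Thm 7.6 (arXiv p. 29: "equivalence between such lower bounds and the existence of a d-local pseudo-density")] -/
theorem CharikarMakarychevMakarychev2009_uniqueGamesSA_of_localExpectations
    (h : ∀ t : ℕ, 1 ≤ t → ∀ δ : ℝ, 0 < δ → δ < 1 → ∀ ε : ℝ, 0 < ε →
      ∃ γ : ℝ, 0 < γ ∧ ∃ n₀ : ℕ, ∀ n : ℕ, n₀ ≤ n →
        ∃ I : UGInstance (2 ^ t) n, I.OptLE ((1 + δ) / 2 ^ t) ∧
          ∃ ℒ : LocalExpectationsOn (Fin n) (Fin (2 ^ t)) ⌊(n : ℝ) ^ γ⌋₊, 1 - ε ≤ I.localValue ℒ) :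
    CharikarMakarychevMakarychev2009_uniqueGamesSA := by
  intro t ht δ hδ hδ1 ε hε
  obtain ⟨γ, hγ, n₀, hn₀⟩ := h t ht δ hδ hδ1 ε hε
  refine ⟨γ, hγ, max n₀ ⌈(2 : ℝ) ^ (1 / γ)⌉₊, fun n hn => ?_⟩
  obtain ⟨I, hI, ℒ, hval⟩ := hn₀ n (le_trans (le_max_left _ _) hn)
  have hd : 2 ≤ ⌊(n : ℝ) ^ γ⌋₊ := by
    have h1 : (2 : ℝ) ^ (1 / γ) ≤ n :=
      le_trans (Nat.le_ceil _) (by exact_mod_cast le_trans (le_max_right _ _) hn)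
    have h2 : (2 : ℝ) ≤ (n : ℝ) ^ γ := by
      calc (2 : ℝ) = ((2 : ℝ) ^ (1 / γ)) ^ γ := by
            rw [← Real.rpow_mul (by norm_num), one_div_mul_cancel hγ.ne', Real.rpow_one]
        _ ≤ (n : ℝ) ^ γ := Real.rpow_le_rpow (by positivity) h1 hγ.le
    exact Nat.le_floor (by exact_mod_cast h2)
  let x₀ : Fin (2 ^ t) := ⟨0, pow_pos (by norm_num) t⟩
  refine ⟨I, hI, ℒ.density x₀, ℒ.isLocalPseudoDensity_density x₀, ?_⟩
  rw [I.muExpect_density_mul_val ℒ hd x₀]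
  exact hval

end Literature.Combinatorics.Optimization
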